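import Summits.BirchSwinnertonDyer.BirchSwinnertonDyer.Theorems.KatoDescentPotSupersingularWildFineSelmerFineUnitAnchor
import Summits.BirchSwinnertonDyer.Rank1Residual.Additive.X4RankZeroKatoBoundTamagawaExact
import Literature.NumberTheory.EllipticCurves.NonEisensteinPrimeOfSurjective
import Literature.NumberTheory.EllipticCurves.Kato2004.Condition1252
import HarnessLib

/-!
# The KATO FINE UNIT-ANCHOR road to the Conj-A crux `WildFineSelmerCoatesSujatha` on the ELKIES rows
# (item stmt-BirchSwinnertonDyer-19386, stub `stub_fineA_wild_surjModThree`; route `KatoDescentPotSupersingular`,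
# rung K9, cell `bsd-potss`): a congruent ADDITIVE potentially-good anchor with SURJECTIVE 3-adic tower,
# `r_an = 0` and `3 ∤ #Ш_an` has `Ш[3] = 0` by Kato's Tamagawa-exact bound (A161″) — so the fine control
# theorem applies to it with purely analytic global data (a `--supports … --as helper` file; seat
# `bsd-potss-k9-c4` g6; ROUTE-FREE; nothing booked, BSD is not proved by any of this)

WHY. On the Elkies rows of the crux (`ρ̄_{E,3}` onto `GL₂(𝔽₃)`, 3-adic tower not onto; 20 rows, 4 ♯) every
congruent partner found by the census of seat `conjA-anchor` g0 (FINDING-19386-19413 §1c) is ADDITIVE or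
multiplicative at `3` — no good-ordinary or CM anchor exists (a CM curve never has `GL₂(𝔽₃)` image) — and the
only certificates at evidence level were the «(A⋆) additive Kato unit anchors» of cell o6-r1 (80 anchors for
18/20 rows), for which no kernel road existed. The fine unit-anchor road of this seat
(`WildFineSelmerFineUnitAnchor.missingUpperBoundAt_wild_of_fineUnitAnchor`, p480349) accepts anchors of ANY
reduction type at `3`; its global input `#Ш(W′)[3^∞] = 1` is, for an anchor `W′` ADDITIVE potentially good at
`3` whose 3-adic tower IS surjective (the generic member of the row's `X_E(3)`-family), a THEOREM below the
route's own cite-only input A161″ (`Kato2004.rankZero_padicValNat_sha_add_padicValNat_tamagawa_le_of_additive_potGood_of_imageContainsSL2`,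
the first conjunct of `KatoTamagawaExactInputs`, item 19191): Kato 14.5 (3) + 14.16 (2) in the Tamagawa-exact
reading give `ord₃ #Ш(W′) ≤ ord₃ #Ш_an(W′)` (`X4RankZero.missingUpperBoundAt_of_katoTam`), so `3 ∤ #Ш_an(W′)`
forces `Ш(W′)[3] = 0`. Hence the per-row data become: congruence, tower-surjectivity of `W′` (mod `9`
suffices), `r_an(W′) = 0`, `3 ∤ #Ш_an(W′)` (Cremona), and the local `3`-torsion tests — no conductor bound, no
descent.

* §1 `not_dvd_natCard_sha_of_towerSurj_of_shaAn` — `3 ∤ #Ш(W′)` for such an anchor (any odd `p`).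
* §2 **`missingUpperBoundAt_wild_of_katoFineUnitAnchor`** (+ `_nine`: surjectivity mod `9` in place of the
  whole tower, `Kato2004.imageContainsSL2_three_iff_hasSurjectiveModNGaloisRep_nine`).

HONEST FRAMING: conditional-results on the displayed named facts (A161″ `hKatoT`, Kato's fine reading
`hKatoA`, Lim–Sujatha `hLS`, GZK, modularity — all already inputs of the route; no new fact); per-row data are
hypotheses (data of record); items 19386/19197 NOT closed; class-wide the crux is Coates–Sujatha (A), a named
open problem. References: [Kato2004Asterisque] Thm. 14.5 (3) (p. 236), Prop. 14.16 (2) (p. 244), (12.5.2)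
(p. 222); [GreenbergLNM1716] Prop. 3.8 (pp. 95–96), §4 Prop. 4.13; [LimSujatha2018] §3 Prop. 3.2;
[CoatesSujatha2005] §3; [Elkies2006] (the 9-deficient family).
-/

set_option autoImplicit false
-- sibling precedent (`KatoDescentPotSupersingularAssembly.lean`): the directory name repeats the summit name
set_option linter.dupNamespace false

noncomputable section

open scoped Classical

universe u

namespace Summit.BirchSwinnertonDyer.BirchSwinnertonDyer.Theorems.WildFineSelmerKatoFineUnitAnchor

open NumberField IsDedekindDomain Field
open WeierstrassCurve Literature.NumberTheory.EllipticCurves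
  Literature.NumberTheory.EllipticCurves.GreenbergSelmer
  Literature.NumberTheory.EllipticCurves.IwasawaAlgebra
  Literature.NumberTheory.EllipticCurves.Rank1Residual
  Literature.NumberTheory.EllipticCurves.Rank1Residual.Typed
  Literature.NumberTheory.EllipticCurves.ZpExtension
  Summit.BirchSwinnertonDyer.Rank1Residual Summit.BirchSwinnertonDyer.Rank1Residual.Additive
  Summit.BirchSwinnertonDyer.Rank1Residual.O6
  Summit.BirchSwinnertonDyer.BirchSwinnertonDyer.Theorems

/-! ## §1 `p ∤ #Ш(W′)` at an additive potentially-good tower-surjective anchor with `p ∤ #Ш_an(W′)` -/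

/-- **Kato's Tamagawa-exact bound makes `p ∤ #Ш_an` an honest `Ш[p] = 0` certificate** at an additive
potentially good odd prime `p` with surjective `p`-adic tower: for `W′/ℚ` globally minimal with
`r_an(W′) = 0`, `Addv W′ p`, `0 ≤ ord_p j(W′)`, `ρ_{W′,p^n}` onto for all `n`, and `#Ш_an(W′) = m` with
`p ∤ m`, the group `Ш(W′/ℚ)` is finite (GZK) of order prime to `p`
(`X4RankZero.missingUpperBoundAt_of_katoTam`: `ord_p #Ш ≤ ord_p #Ш_an = 0`).
[cite: Kato2004Asterisque, Thm. 14.5 (3) (p. 236), Prop. 14.16 (2) (p. 244)] [cite: GreenbergLNM1716, §4 Prop. 4.13] -/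
theorem not_dvd_natCard_sha_of_towerSurj_of_shaAn
    (hKatoT :
      Kato2004.rankZero_padicValNat_sha_add_padicValNat_tamagawa_le_of_additive_potGood_of_imageContainsSL2)
    (hGZK : rank_eq_analyticRank_of_analyticRank_le_one) (hmod : hasEntireLFunction_rat)
    (W' : WeierstrassCurve ℚ) [W'.IsElliptic] [W'.IsGloballyMinimal] (p : ℕ) [Fact p.Prime] (hp : p ≠ 2)
    (hr' : W'.analyticRank = 0) (hA' : Addv W' p) (hj' : 0 ≤ padicValRat p W'.j)
    (hsurj' : ∀ n : ℕ, W'.HasSurjectiveModNGaloisRep (p ^ n : ℕ))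
    {m : ℕ} (hshaAn' : shaAn W' = (m : ℂ)) (hm : ¬ p ∣ m) :
    Finite W'.sha ∧ ¬ p ∣ Nat.card W'.sha := by
  haveI : NeZero (p : ℚ) := ⟨Nat.cast_ne_zero.mpr (Fact.out : p.Prime).ne_zero⟩
  have hirr' : W'.HasIrreducibleModPGaloisRep p := by
    have h1 := hsurj' 1
    rw [pow_one] at h1
    exact hasIrreducibleModPGaloisRep_of_hasSurjectiveModNGaloisRep W' p (by exact_mod_cast h1)
  obtain ⟨-, hfin⟩ := hGZK W' (by rw [hr']; exact zero_le_one)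
  haveI : Finite W'.sha := hfin
  obtain ⟨q, hq, hle⟩ :=
    X4RankZero.missingUpperBoundAt_of_katoTam W' p hKatoT hGZK hmod hr' ⟨hp, hA', hirr'⟩ hj' hsurj'
  have hqm : q = (m : ℚ) := by
    have h : ((q : ℚ) : ℂ) = ((m : ℚ) : ℂ) := by rw [← hq, hshaAn']; push_cast; rfl
    exact_mod_cast h
  rw [hqm, padicValRat.of_nat, padicValNat.eq_zero_of_not_dvd hm, Nat.cast_zero] at hle
  have h0 : padicValNat p W'.shaOrder = 0 := by exact_mod_cast le_antisymm hle (Nat.cast_nonneg _)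
  refine ⟨hfin, fun hdvd ↦ ?_⟩
  have hcard : W'.shaOrder ≠ 0 := (Nat.card_pos (α := W'.sha)).ne'
  rcases padicValNat.eq_zero_iff.1 h0 with h | h | h
  · exact (Fact.out : p.Prime).one_lt.ne' h
  · exact hcard h
  · exact h hdvd

/-! ## §2 The row road on the Elkies rows: an additive tower-surjective anchor with analytic unit data -/

/-- **The KATO FINE UNIT-ANCHOR road, row form.** Let `W/ℚ` be a row of the Conj-A crux of route K9
(globally minimal, `r_an = 0`, `ClassO6 W 3`, `W[3]` irreducible) and `W′/ℚ` a globally minimal elliptic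
curve with `W′[3] ≅ W[3]`, ADDITIVE potentially good at `3` (`Addv W′ 3`, `0 ≤ ord₃ j`), 3-adic tower
SURJECTIVE, `r_an(W′) = 0`, `#Ш_an(W′) = m` with `3 ∤ m`, and — for a finite set `S` of places off which `W′`
is good and `v ∤ 3` — no non-zero `D_v`-fixed `3`-torsion in `W′[3^∞]` for `v ∈ S` (`W′(ℚ_v)[3] = 0`; at `v = 3`
a ROW test). Then `ord₃ #Ш(W) ≤ ord₃ #Ш_an(W)`: §1 (A161″) gives `3 ∤ #Ш(W′)`, and the fine unit-anchor road
`WildFineSelmerFineUnitAnchor.missingUpperBoundAt_wild_of_fineUnitAnchor_analytic` concludes.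
[cite: Kato2004Asterisque, Thm. 14.5 (3) (p. 236), Prop. 14.16 (2) (p. 244)]
[cite: GreenbergLNM1716, Prop. 3.8 (pp. 95–96)] [cite: LimSujatha2018, §3 Prop. 3.2] -/
theorem missingUpperBoundAt_wild_of_katoFineUnitAnchor
    (hKatoT :
      Kato2004.rankZero_padicValNat_sha_add_padicValNat_tamagawa_le_of_additive_potGood_of_imageContainsSL2)
    (hLS : LimSujatha2018.prop32_fineSelmerDual_moduleFinite_iff_of_torsionIso)
    (hKatoA :
      Kato2004.rankZero_padicValNat_sha_add_padicValNat_tamagawa_le_of_additive_potGood_of_irreducible_of_fineSelmerDual_fg)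
    (hGZK : rank_eq_analyticRank_of_analyticRank_le_one) (hmod : hasEntireLFunction_rat)
    (W : WeierstrassCurve ℚ) [W.IsElliptic] [W.IsGloballyMinimal] [Fact (3 : ℕ).Prime]
    (hr : W.analyticRank = 0) (hO : ClassO6 W 3) (hirr : W.HasIrreducibleModPGaloisRep 3)
    (W' : WeierstrassCurve ℚ) [W'.IsElliptic] [W'.IsGloballyMinimal] (hcong : ModPCongruent W' W 3)
    (hr' : W'.analyticRank = 0) (hA' : Addv W' 3) (hj' : 0 ≤ padicValRat 3 W'.j)
    (hsurj' : ∀ n : ℕ, W'.HasSurjectiveModNGaloisRep (3 ^ n : ℕ))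
    {m : ℕ} (hshaAn' : shaAn W' = (m : ℂ)) (hm : ¬ 3 ∣ m)
    (S : Finset (HeightOneSpectrum (𝓞 ℚ)))
    (hS : ∀ v ∉ S, ((3 : ℕ) : 𝓞 ℚ) ∉ v.asIdeal ∧ W'.HasGoodReductionAt v)
    (hloc' : ∀ v ∈ S, ∀ x : W'.geomPrimaryTorsion 3, 3 • x = 0 → (∀ d ∈ decomp v, d • x = x) → x = 0) :
    MissingUpperBoundAt W 3 := by
  obtain ⟨-, hsha'⟩ := not_dvd_natCard_sha_of_towerSurj_of_shaAn hKatoT hGZK hmod W' 3 (by norm_num) hr'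
    hA' hj' hsurj' hshaAn' hm
  exact WildFineSelmerFineUnitAnchor.missingUpperBoundAt_wild_of_fineUnitAnchor_analytic hLS hKatoA hGZK
    hmod W hr hO hirr W' hcong S hS hr' hsha' hloc'

/-- **The same with surjectivity MOD 9** in place of the whole 3-adic tower (Serre / Kato (12.5.2) at
`p = 3`: `Kato2004.imageContainsSL2_three_iff_hasSurjectiveModNGaloisRep_nine`,
`forall_hasSurjectiveModNGaloisRep_of_imageContainsSL2`) — the finite check a census performs.
[cite: Kato2004Asterisque, (12.5.2) (p. 222) and Thm. 14.5 (3) (p. 236)] [cite: LimSujatha2018, §3 Prop. 3.2] -/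
theorem missingUpperBoundAt_wild_of_katoFineUnitAnchor_nine
    (hKatoT :
      Kato2004.rankZero_padicValNat_sha_add_padicValNat_tamagawa_le_of_additive_potGood_of_imageContainsSL2)
    (hLS : LimSujatha2018.prop32_fineSelmerDual_moduleFinite_iff_of_torsionIso)
    (hKatoA :
      Kato2004.rankZero_padicValNat_sha_add_padicValNat_tamagawa_le_of_additive_potGood_of_irreducible_of_fineSelmerDual_fg)
    (hGZK : rank_eq_analyticRank_of_analyticRank_le_one) (hmod : hasEntireLFunction_rat)
    (W : WeierstrassCurve ℚ) [W.IsElliptic] [W.IsGloballyMinimal] [Fact (3 : ℕ).Prime]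
    (hr : W.analyticRank = 0) (hO : ClassO6 W 3) (hirr : W.HasIrreducibleModPGaloisRep 3)
    (W' : WeierstrassCurve ℚ) [W'.IsElliptic] [W'.IsGloballyMinimal] (hcong : ModPCongruent W' W 3)
    (hr' : W'.analyticRank = 0) (hA' : Addv W' 3) (hj' : 0 ≤ padicValRat 3 W'.j)
    (hsurj9 : W'.HasSurjectiveModNGaloisRep 9)
    {m : ℕ} (hshaAn' : shaAn W' = (m : ℂ)) (hm : ¬ 3 ∣ m)
    (S : Finset (HeightOneSpectrum (𝓞 ℚ)))
    (hS : ∀ v ∉ S, ((3 : ℕ) : 𝓞 ℚ) ∉ v.asIdeal ∧ W'.HasGoodReductionAt v)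
    (hloc' : ∀ v ∈ S, ∀ x : W'.geomPrimaryTorsion 3, 3 • x = 0 → (∀ d ∈ decomp v, d • x = x) → x = 0) :
    MissingUpperBoundAt W 3 :=
  missingUpperBoundAt_wild_of_katoFineUnitAnchor hKatoT hLS hKatoA hGZK hmod W hr hO hirr W' hcong hr' hA' hj'
    (Kato2004.forall_hasSurjectiveModNGaloisRep_of_imageContainsSL2 (W := W') (p := 3)
      ((Kato2004.imageContainsSL2_three_iff_hasSurjectiveModNGaloisRep_nine W').2 hsurj9))
    hshaAn' hm S hS hloc'

end Summit.BirchSwinnertonDyer.BirchSwinnertonDyer.Theorems.WildFineSelmerKatoFineUnitAnchor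

end
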